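import Summits.CriticalPhenomena.PercolationContinuityZ3.Theorems.PercNearOneGluingNoHeavyLowerTailAntipodalR1GradedFibreFormSteps
import HarnessLib

/-!
# ANTI₁-GRADED implies its fibre form, II: peeling a doubled edge; the theorem

Support file for `stmt-CriticalPhenomena-4575` (memo `prim-gen-kcluster/KCLUSTER-gen52.md` §1, LEMMA F —
the combinatorial half; `KCLUSTER-gen78.md`).  No definitions, no named facts, no sorries.  Vocabulary of
`AntipodalR1` (gen 62), parts IV/V/IX (loops, contraction, graded contraction) and the relabelling lemmas
of gen 78.

In the fibre decomposition of a product of two random-cluster measures (gen-52 LEMMA F), a fibre is a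
set of free edges together with a set of edges that are open in BOTH copies; in the antipodal dictionary
the latter join their ends in both the open and the closed graph — an open and a closed parallel pair —
and the fibre inequality is ANTI₁-GRADED restricted to the colourings `A ⊕ (p ↦ p.2)` of the system
`Sum.elim endsD (fun p : κ × Bool => f p.1)` ("fibre form").

**Theorem** (`card_fibreForm_grade_le_of_graded`).  Fix the (finite) vertex type `V` and the free edge
type `ι`.  If ANTI₁-GRADED holds for EVERY system `ends' : ι → Sym2 V` (all placements `a, b, c`, all
levels), then the fibre form holds for every `endsD : ι → Sym2 V`, every finite family of doubled edges
`f : κ → Sym2 V`, all `a, b, c` and all levels.  Proof: induction on `κ` (`Finite.induction_empty_option`);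
a doubled edge `uv` with `u ≠ v` is contracted (part IX: the fibre over the pair is the contraction at the
level shifted by `2`, and the contraction of a pair system is again a pair system on the same edge types),
a doubled loop is deleted (part IV), relabellings by `…Reindex`.  [this work]
-/

namespace Summit.CriticalPhenomena.PercolationContinuityZ3.Theorems

namespace AntipodalR1

open Finset Relation SimpleGraph

universe w w'

variable {V ι : Type*} [DecidableEq V] [Fintype V] [Fintype ι] [DecidableEq ι]

section Steps

/-- **Peeling one doubled edge.** [this work] -/
theorem card_fibreForm_grade_le_option {κ : Type w} [Fintype κ] [DecidableEq κ]
    (h : ∀ (f : κ → Sym2 V) (endsD : ι → Sym2 V) (a b c : V) (t : ℕ),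
      (univ.filter fun A : ι → Bool =>
        Sum.elim A Prod.snd ∈ lSet (Sum.elim endsD (fun p : κ × Bool => f p.1)) a b c ∧
        (Nat.card (fromEdgeSet {s : Sym2 V | ∃ e, Sum.elim A Prod.snd e = true ∧
          (Sum.elim endsD (fun p : κ × Bool => f p.1)) e = s}).ConnectedComponent +
        Nat.card (fromEdgeSet {s : Sym2 V | ∃ e, Sum.elim A Prod.snd e = false ∧
          (Sum.elim endsD (fun p : κ × Bool => f p.1)) e = s}).ConnectedComponent) = t).card ≤
      (univ.filter fun A : ι → Bool =>
        Sum.elim A Prod.snd ∈ rSet (Sum.elim endsD (fun p : κ × Bool => f p.1)) a b c ∧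
        (Nat.card (fromEdgeSet {s : Sym2 V | ∃ e, Sum.elim A Prod.snd e = true ∧
          (Sum.elim endsD (fun p : κ × Bool => f p.1)) e = s}).ConnectedComponent +
        Nat.card (fromEdgeSet {s : Sym2 V | ∃ e, Sum.elim A Prod.snd e = false ∧
          (Sum.elim endsD (fun p : κ × Bool => f p.1)) e = s}).ConnectedComponent) = t).card)
    (f : Option κ → Sym2 V) (endsD : ι → Sym2 V) (a b c : V) (t : ℕ) :
    (univ.filter fun A : ι → Bool =>
        Sum.elim A Prod.snd ∈ lSet (Sum.elim endsD (fun p : Option κ × Bool => f p.1)) a b c ∧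
        (Nat.card (fromEdgeSet {s : Sym2 V | ∃ e, Sum.elim A Prod.snd e = true ∧
          (Sum.elim endsD (fun p : Option κ × Bool => f p.1)) e = s}).ConnectedComponent +
        Nat.card (fromEdgeSet {s : Sym2 V | ∃ e, Sum.elim A Prod.snd e = false ∧
          (Sum.elim endsD (fun p : Option κ × Bool => f p.1)) e = s}).ConnectedComponent) = t).card ≤
      (univ.filter fun A : ι → Bool =>
        Sum.elim A Prod.snd ∈ rSet (Sum.elim endsD (fun p : Option κ × Bool => f p.1)) a b c ∧
        (Nat.card (fromEdgeSet {s : Sym2 V | ∃ e, Sum.elim A Prod.snd e = true ∧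
          (Sum.elim endsD (fun p : Option κ × Bool => f p.1)) e = s}).ConnectedComponent +
        Nat.card (fromEdgeSet {s : Sym2 V | ∃ e, Sum.elim A Prod.snd e = false ∧
          (Sum.elim endsD (fun p : Option κ × Bool => f p.1)) e = s}).ConnectedComponent) = t).card := by
  classical
  obtain ⟨u, v, huv⟩ : ∃ u v, f none = s(u, v) := Sym2.ind (fun p q => ⟨p, q, rfl⟩) (f none)
  let e : (ι ⊕ (κ × Bool)) ⊕ Bool ≃ ι ⊕ (Option κ × Bool) :=
    ⟨fun z => Sum.elim (Sum.elim (fun i => Sum.inl i) (fun p => Sum.inr (some p.1, p.2)))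
        (fun β => Sum.inr (none, β)) z,
     fun z => Sum.elim (fun i => Sum.inl (Sum.inl i))
        (fun p => Option.elim p.1 (Sum.inr p.2) (fun k => Sum.inl (Sum.inr (k, p.2)))) z,
     fun z => by rcases z with (i | ⟨k, β⟩) | β <;> rfl,
     fun z => by rcases z with i | ⟨_ | k, β⟩ <;> rfl⟩
  have hsys : (Sum.elim endsD (fun p : Option κ × Bool => f p.1)) ∘ e =
      Sum.elim (Sum.elim endsD (fun p : κ × Bool => f (some p.1))) (fun _ : Bool => s(u, v)) := by
    funext z; rcases z with (i | ⟨k, β⟩) | β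
    · rfl
    · rfl
    · exact huv
  have hcol : ∀ A : ι → Bool, (Sum.elim A Prod.snd : ι ⊕ (Option κ × Bool) → Bool) ∘ e =
      Sum.elim (Sum.elim A Prod.snd : ι ⊕ (κ × Bool) → Bool) id := by
    intro A; funext z; rcases z with (i | ⟨k, β⟩) | β <;> rfl
  have hL : ∀ A : ι → Bool,
      Sum.elim A Prod.snd ∈ lSet (Sum.elim endsD (fun p : Option κ × Bool => f p.1)) a b c ↔
      Sum.elim (Sum.elim A Prod.snd) id ∈
        lSet (Sum.elim (Sum.elim endsD (fun p : κ × Bool => f (some p.1)))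
          (fun _ : Bool => s(u, v))) a b c := by
    intro A; rw [← mem_lSet_comp_equiv e, hsys, hcol]
  have hR : ∀ A : ι → Bool,
      Sum.elim A Prod.snd ∈ rSet (Sum.elim endsD (fun p : Option κ × Bool => f p.1)) a b c ↔
      Sum.elim (Sum.elim A Prod.snd) id ∈
        rSet (Sum.elim (Sum.elim endsD (fun p : κ × Bool => f (some p.1)))
          (fun _ : Bool => s(u, v))) a b c := by
    intro A; rw [← mem_rSet_comp_equiv e, hsys, hcol]
  have hg : ∀ (A : ι → Bool) (col : Bool),
      fromEdgeSet {s : Sym2 V | ∃ x, Sum.elim A Prod.snd x = col ∧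
        Sum.elim endsD (fun p : Option κ × Bool => f p.1) x = s} =
      fromEdgeSet {s : Sym2 V | ∃ x, Sum.elim (Sum.elim A Prod.snd) id x = col ∧
        Sum.elim (Sum.elim endsD (fun p : κ × Bool => f (some p.1)))
          (fun _ : Bool => s(u, v)) x = s} := by
    intro A col
    rw [← colGraph_comp_equiv e (Sum.elim endsD (fun p : Option κ × Bool => f p.1))
      (Sum.elim A Prod.snd) col, hsys, hcol]
  by_cases hne : u = v
  · -- a doubled LOOP: delete it
    subst hne
    have hL' : ∀ A : ι → Bool,
        Sum.elim A Prod.snd ∈ lSet (Sum.elim endsD (fun p : Option κ × Bool => f p.1)) a b c ↔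
        Sum.elim A Prod.snd ∈ lSet (Sum.elim endsD (fun p : κ × Bool => f (some p.1))) a b c := by
      intro A; rw [hL, mem_lSet_loops_iff]; exact Iff.rfl
    have hR' : ∀ A : ι → Bool,
        Sum.elim A Prod.snd ∈ rSet (Sum.elim endsD (fun p : Option κ × Bool => f p.1)) a b c ↔
        Sum.elim A Prod.snd ∈ rSet (Sum.elim endsD (fun p : κ × Bool => f (some p.1))) a b c := by
      intro A; rw [hR, mem_rSet_loops_iff]; exact Iff.rfl
    have hg' : ∀ (A : ι → Bool) (col : Bool),
        fromEdgeSet {s : Sym2 V | ∃ x, Sum.elim A Prod.snd x = col ∧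
          Sum.elim endsD (fun p : Option κ × Bool => f p.1) x = s} =
        fromEdgeSet {s : Sym2 V | ∃ x, Sum.elim A Prod.snd x = col ∧
          Sum.elim endsD (fun p : κ × Bool => f (some p.1)) x = s} := by
      intro A col; rw [hg, colGraph_loops_eq]; rfl
    have e1 : (univ.filter fun A : ι → Bool =>
        Sum.elim A Prod.snd ∈ lSet (Sum.elim endsD (fun p : Option κ × Bool => f p.1)) a b c ∧
        (Nat.card (fromEdgeSet {s : Sym2 V | ∃ e, Sum.elim A Prod.snd e = true ∧
          (Sum.elim endsD (fun p : Option κ × Bool => f p.1)) e = s}).ConnectedComponent +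
        Nat.card (fromEdgeSet {s : Sym2 V | ∃ e, Sum.elim A Prod.snd e = false ∧
          (Sum.elim endsD (fun p : Option κ × Bool => f p.1)) e = s}).ConnectedComponent) = t).card =
        (univ.filter fun A : ι → Bool =>
        Sum.elim A Prod.snd ∈ lSet (Sum.elim endsD (fun p : κ × Bool => (fun k => f (some k)) p.1)) a b c ∧
        (Nat.card (fromEdgeSet {s : Sym2 V | ∃ e, Sum.elim A Prod.snd e = true ∧
          (Sum.elim endsD (fun p : κ × Bool => (fun k => f (some k)) p.1)) e = s}).ConnectedComponent +
        Nat.card (fromEdgeSet {s : Sym2 V | ∃ e, Sum.elim A Prod.snd e = false ∧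
          (Sum.elim endsD (fun p : κ × Bool => (fun k => f (some k)) p.1)) e = s}).ConnectedComponent) = t).card :=
      congrArg Finset.card (filter_congr fun A _ => by rw [hL', hg', hg'])
    have e2 : (univ.filter fun A : ι → Bool =>
        Sum.elim A Prod.snd ∈ rSet (Sum.elim endsD (fun p : Option κ × Bool => f p.1)) a b c ∧
        (Nat.card (fromEdgeSet {s : Sym2 V | ∃ e, Sum.elim A Prod.snd e = true ∧
          (Sum.elim endsD (fun p : Option κ × Bool => f p.1)) e = s}).ConnectedComponent +
        Nat.card (fromEdgeSet {s : Sym2 V | ∃ e, Sum.elim A Prod.snd e = false ∧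
          (Sum.elim endsD (fun p : Option κ × Bool => f p.1)) e = s}).ConnectedComponent) = t).card =
        (univ.filter fun A : ι → Bool =>
        Sum.elim A Prod.snd ∈ rSet (Sum.elim endsD (fun p : κ × Bool => (fun k => f (some k)) p.1)) a b c ∧
        (Nat.card (fromEdgeSet {s : Sym2 V | ∃ e, Sum.elim A Prod.snd e = true ∧
          (Sum.elim endsD (fun p : κ × Bool => (fun k => f (some k)) p.1)) e = s}).ConnectedComponent +
        Nat.card (fromEdgeSet {s : Sym2 V | ∃ e, Sum.elim A Prod.snd e = false ∧
          (Sum.elim endsD (fun p : κ × Bool => (fun k => f (some k)) p.1)) e = s}).ConnectedComponent) = t).card :=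
      congrArg Finset.card (filter_congr fun A _ => by rw [hR', hg', hg'])
    rw [e1, e2]; exact h (fun k => f (some k)) endsD a b c t
  · -- a doubled EDGE `uv`, `u ≠ v`: contract it
    have hcontr : (fun i => ((Sum.elim endsD (fun p : κ × Bool => f (some p.1))) i).map
        fun w => if w = v then u else w) =
        (Sum.elim (fun i => (endsD i).map fun w => if w = v then u else w) (fun p : κ × Bool => (fun k => (f (some k)).map fun w => if w = v then u else w) p.1)) := by
      funext z; rcases z with i | ⟨k, β⟩ <;> rfl
    have hL' : ∀ A : ι → Bool,
        Sum.elim A Prod.snd ∈ lSet (Sum.elim endsD (fun p : Option κ × Bool => f p.1)) a b c ↔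
        Sum.elim A Prod.snd ∈ lSet (Sum.elim (fun i => (endsD i).map fun w => if w = v then u else w) (fun p : κ × Bool => (fun k => (f (some k)).map fun w => if w = v then u else w) p.1))
          (if a = v then u else a) (if b = v then u else b) (if c = v then u else c) := by
      intro A; rw [hL, mem_lSet_pair_iff, hcontr]
    have hR' : ∀ A : ι → Bool,
        Sum.elim A Prod.snd ∈ rSet (Sum.elim endsD (fun p : Option κ × Bool => f p.1)) a b c ↔
        Sum.elim A Prod.snd ∈ rSet (Sum.elim (fun i => (endsD i).map fun w => if w = v then u else w) (fun p : κ × Bool => (fun k => (f (some k)).map fun w => if w = v then u else w) p.1))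
          (if a = v then u else a) (if b = v then u else b) (if c = v then u else c) := by
      intro A; rw [hR, mem_rSet_pair_iff, hcontr]
    have hg' : ∀ A : ι → Bool,
        (Nat.card (fromEdgeSet {s : Sym2 V | ∃ e, Sum.elim A Prod.snd e = true ∧
          (Sum.elim endsD (fun p : Option κ × Bool => f p.1)) e = s}).ConnectedComponent +
        Nat.card (fromEdgeSet {s : Sym2 V | ∃ e, Sum.elim A Prod.snd e = false ∧
          (Sum.elim endsD (fun p : Option κ × Bool => f p.1)) e = s}).ConnectedComponent) + 2 =
        (Nat.card (fromEdgeSet {s : Sym2 V | ∃ e, Sum.elim A Prod.snd e = true ∧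
          (Sum.elim (fun i => (endsD i).map fun w => if w = v then u else w) (fun p : κ × Bool => (fun k => (f (some k)).map fun w => if w = v then u else w) p.1)) e = s}).ConnectedComponent +
        Nat.card (fromEdgeSet {s : Sym2 V | ∃ e, Sum.elim A Prod.snd e = false ∧
          (Sum.elim (fun i => (endsD i).map fun w => if w = v then u else w) (fun p : κ × Bool => (fun k => (f (some k)).map fun w => if w = v then u else w) p.1)) e = s}).ConnectedComponent) := by
      intro A
      rw [hg, hg, ← hcontr, ← grade_contract_eq hne (Sum.elim A Prod.snd)]
    have e1 : (univ.filter fun A : ι → Bool =>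
        Sum.elim A Prod.snd ∈ lSet (Sum.elim endsD (fun p : Option κ × Bool => f p.1)) a b c ∧
        (Nat.card (fromEdgeSet {s : Sym2 V | ∃ e, Sum.elim A Prod.snd e = true ∧
          (Sum.elim endsD (fun p : Option κ × Bool => f p.1)) e = s}).ConnectedComponent +
        Nat.card (fromEdgeSet {s : Sym2 V | ∃ e, Sum.elim A Prod.snd e = false ∧
          (Sum.elim endsD (fun p : Option κ × Bool => f p.1)) e = s}).ConnectedComponent) = t).card =
        (univ.filter fun A : ι → Bool =>
        Sum.elim A Prod.snd ∈ lSet (Sum.elim (fun i => (endsD i).map fun w => if w = v then u else w) (fun p : κ × Bool => (fun k => (f (some k)).map fun w => if w = v then u else w) p.1)) (if a = v then u else a) (if b = v then u else b) (if c = v then u else c) ∧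
        (Nat.card (fromEdgeSet {s : Sym2 V | ∃ e, Sum.elim A Prod.snd e = true ∧
          (Sum.elim (fun i => (endsD i).map fun w => if w = v then u else w) (fun p : κ × Bool => (fun k => (f (some k)).map fun w => if w = v then u else w) p.1)) e = s}).ConnectedComponent +
        Nat.card (fromEdgeSet {s : Sym2 V | ∃ e, Sum.elim A Prod.snd e = false ∧
          (Sum.elim (fun i => (endsD i).map fun w => if w = v then u else w) (fun p : κ × Bool => (fun k => (f (some k)).map fun w => if w = v then u else w) p.1)) e = s}).ConnectedComponent) = t + 2).card :=
      congrArg Finset.card (filter_congr fun A _ => by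
        rw [hL']
        constructor
        · rintro ⟨h1, h2⟩; exact ⟨h1, by have := hg' A; omega⟩
        · rintro ⟨h1, h2⟩; exact ⟨h1, by have := hg' A; omega⟩)
    have e2 : (univ.filter fun A : ι → Bool =>
        Sum.elim A Prod.snd ∈ rSet (Sum.elim endsD (fun p : Option κ × Bool => f p.1)) a b c ∧
        (Nat.card (fromEdgeSet {s : Sym2 V | ∃ e, Sum.elim A Prod.snd e = true ∧
          (Sum.elim endsD (fun p : Option κ × Bool => f p.1)) e = s}).ConnectedComponent +
        Nat.card (fromEdgeSet {s : Sym2 V | ∃ e, Sum.elim A Prod.snd e = false ∧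
          (Sum.elim endsD (fun p : Option κ × Bool => f p.1)) e = s}).ConnectedComponent) = t).card =
        (univ.filter fun A : ι → Bool =>
        Sum.elim A Prod.snd ∈ rSet (Sum.elim (fun i => (endsD i).map fun w => if w = v then u else w) (fun p : κ × Bool => (fun k => (f (some k)).map fun w => if w = v then u else w) p.1)) (if a = v then u else a) (if b = v then u else b) (if c = v then u else c) ∧
        (Nat.card (fromEdgeSet {s : Sym2 V | ∃ e, Sum.elim A Prod.snd e = true ∧
          (Sum.elim (fun i => (endsD i).map fun w => if w = v then u else w) (fun p : κ × Bool => (fun k => (f (some k)).map fun w => if w = v then u else w) p.1)) e = s}).ConnectedComponent +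
        Nat.card (fromEdgeSet {s : Sym2 V | ∃ e, Sum.elim A Prod.snd e = false ∧
          (Sum.elim (fun i => (endsD i).map fun w => if w = v then u else w) (fun p : κ × Bool => (fun k => (f (some k)).map fun w => if w = v then u else w) p.1)) e = s}).ConnectedComponent) = t + 2).card :=
      congrArg Finset.card (filter_congr fun A _ => by
        rw [hR']
        constructor
        · rintro ⟨h1, h2⟩; exact ⟨h1, by have := hg' A; omega⟩
        · rintro ⟨h1, h2⟩; exact ⟨h1, by have := hg' A; omega⟩)
    rw [e1, e2]
    exact h (fun k => (f (some k)).map fun w => if w = v then u else w)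
      (fun i => (endsD i).map fun w => if w = v then u else w)
      (if a = v then u else a) (if b = v then u else b) (if c = v then u else c) (t + 2)

end Steps


/-- The fibre form for `Fin n` doubled edges, by induction on `n`. [this work] -/
theorem card_fibreForm_grade_le_fin
    (H : ∀ (ends' : ι → Sym2 V) (a b c : V) (t : ℕ),
      (univ.filter fun x : ι → Bool => x ∈ lSet ends' a b c ∧
        (Nat.card (fromEdgeSet {s : Sym2 V | ∃ e, x e = true ∧
          ends' e = s}).ConnectedComponent +
        Nat.card (fromEdgeSet {s : Sym2 V | ∃ e, x e = false ∧
          ends' e = s}).ConnectedComponent) = t).card ≤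
      (univ.filter fun x : ι → Bool => x ∈ rSet ends' a b c ∧
        (Nat.card (fromEdgeSet {s : Sym2 V | ∃ e, x e = true ∧
          ends' e = s}).ConnectedComponent +
        Nat.card (fromEdgeSet {s : Sym2 V | ∃ e, x e = false ∧
          ends' e = s}).ConnectedComponent) = t).card)
    (n : ℕ) : ∀ (f : Fin n → Sym2 V) (endsD : ι → Sym2 V) (a b c : V) (t : ℕ),
    (univ.filter fun A : ι → Bool =>
        Sum.elim A Prod.snd ∈ lSet (Sum.elim endsD (fun p : Fin n × Bool => f p.1)) a b c ∧
        (Nat.card (fromEdgeSet {s : Sym2 V | ∃ e, Sum.elim A Prod.snd e = true ∧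
          (Sum.elim endsD (fun p : Fin n × Bool => f p.1)) e = s}).ConnectedComponent +
        Nat.card (fromEdgeSet {s : Sym2 V | ∃ e, Sum.elim A Prod.snd e = false ∧
          (Sum.elim endsD (fun p : Fin n × Bool => f p.1)) e = s}).ConnectedComponent) = t).card ≤
      (univ.filter fun A : ι → Bool =>
        Sum.elim A Prod.snd ∈ rSet (Sum.elim endsD (fun p : Fin n × Bool => f p.1)) a b c ∧
        (Nat.card (fromEdgeSet {s : Sym2 V | ∃ e, Sum.elim A Prod.snd e = true ∧
          (Sum.elim endsD (fun p : Fin n × Bool => f p.1)) e = s}).ConnectedComponent +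
        Nat.card (fromEdgeSet {s : Sym2 V | ∃ e, Sum.elim A Prod.snd e = false ∧
          (Sum.elim endsD (fun p : Fin n × Bool => f p.1)) e = s}).ConnectedComponent) = t).card := by
  induction n with
  | zero =>
    intro f endsD a b c t
    exact card_fibreForm_grade_le_of_equiv (Equiv.equivOfIsEmpty PEmpty.{1} (Fin 0))
      (card_fibreForm_grade_le_empty H) f endsD a b c t
  | succ n ih =>
    intro f endsD a b c t
    exact card_fibreForm_grade_le_of_equiv (finSuccEquiv n).symm
      (card_fibreForm_grade_le_option ih) f endsD a b c t

/-- **ANTI₁-GRADED ⟹ its fibre form** (gen-52 LEMMA F, combinatorial half).  If every edge system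
`ends' : ι → Sym2 V` satisfies ANTI₁-GRADED for all placements and levels, then for every system
`endsD : ι → Sym2 V`, every finite family `f : κ → Sym2 V` of doubled edges (each present once OPEN and once
CLOSED) and all `a, b, c, t`: among the colourings `A ⊕ (p ↦ p.2)` of
`Sum.elim endsD (fun p : κ × Bool => f p.1)`, level by level `L` has at most as many elements as `R(b,c)`.
[this work] -/
theorem card_fibreForm_grade_le_of_graded
    (H : ∀ (ends' : ι → Sym2 V) (a b c : V) (t : ℕ),
      (univ.filter fun x : ι → Bool => x ∈ lSet ends' a b c ∧
        (Nat.card (fromEdgeSet {s : Sym2 V | ∃ e, x e = true ∧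
          ends' e = s}).ConnectedComponent +
        Nat.card (fromEdgeSet {s : Sym2 V | ∃ e, x e = false ∧
          ends' e = s}).ConnectedComponent) = t).card ≤
      (univ.filter fun x : ι → Bool => x ∈ rSet ends' a b c ∧
        (Nat.card (fromEdgeSet {s : Sym2 V | ∃ e, x e = true ∧
          ends' e = s}).ConnectedComponent +
        Nat.card (fromEdgeSet {s : Sym2 V | ∃ e, x e = false ∧
          ends' e = s}).ConnectedComponent) = t).card)
    (κ : Type w) [Fintype κ] [DecidableEq κ]
    (f : κ → Sym2 V) (endsD : ι → Sym2 V) (a b c : V) (t : ℕ) :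
    (univ.filter fun A : ι → Bool =>
        Sum.elim A Prod.snd ∈ lSet (Sum.elim endsD (fun p : κ × Bool => f p.1)) a b c ∧
        (Nat.card (fromEdgeSet {s : Sym2 V | ∃ e, Sum.elim A Prod.snd e = true ∧
          (Sum.elim endsD (fun p : κ × Bool => f p.1)) e = s}).ConnectedComponent +
        Nat.card (fromEdgeSet {s : Sym2 V | ∃ e, Sum.elim A Prod.snd e = false ∧
          (Sum.elim endsD (fun p : κ × Bool => f p.1)) e = s}).ConnectedComponent) = t).card ≤
      (univ.filter fun A : ι → Bool =>
        Sum.elim A Prod.snd ∈ rSet (Sum.elim endsD (fun p : κ × Bool => f p.1)) a b c ∧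
        (Nat.card (fromEdgeSet {s : Sym2 V | ∃ e, Sum.elim A Prod.snd e = true ∧
          (Sum.elim endsD (fun p : κ × Bool => f p.1)) e = s}).ConnectedComponent +
        Nat.card (fromEdgeSet {s : Sym2 V | ∃ e, Sum.elim A Prod.snd e = false ∧
          (Sum.elim endsD (fun p : κ × Bool => f p.1)) e = s}).ConnectedComponent) = t).card :=
  card_fibreForm_grade_le_of_equiv (Fintype.equivFin κ).symm
    (card_fibreForm_grade_le_fin H (Fintype.card κ)) f endsD a b c t

end AntipodalR1

end Summit.CriticalPhenomena.PercolationContinuityZ3.Theorems
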